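import Summits.NavierStokesRegularity.NavierStokesRegularity.Theses.BernoulliDeceleration
import HarnessLib

/-!
# Birth skeleton of the child `HeadTypeIOnDeceleratingSet` (split of `DeceleratingSetHeadBound`)

Child C1 of the prepared split of stmt-NavierStokesRegularity-3032 (route `BernoulliDeceleration`):
"the Bernoulli head obeys the Type-I rate `(T - t) Π̃ ≤ C` on the decelerating set" — the Type-II
exclusion for the head. Line `critical one-sided integrability`:

* `stub_criticalHeadIntegrability` — the positive part of the head has bounded CRITICAL
  (scale-invariant) Lebesgue norm, uniformly in time: `sup_t ∫ (Π̃₊)^(3/2) dx < ∞` on `[0, T)`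
  (typed with `∫⁻` and `ENNReal.ofReal`, which clamps the negative part to `0`: no junk value).
  This is where the route's bet acts: on `D` the local energy balance has the favourable sign
  `∂ₜ(‖u‖²/2) ≤ -ν‖ω‖²`, `Π̃₊` lives where `‖u‖²/2 > -p̃`, and `∫ p̃ = -‖u‖²/3`-type identities
  control the positive excursions of the head in the mean; an energy-class (De Giorgi / Moser on
  `D`) estimate is asked to make this critical rather than supercritical;
* `stub_typeIRateOfCriticalHead` — a bounded critical one-sided norm forces the Type-I RATE of
  the head (the one-sided-head analogue of "`L^∞_t L^(3,∞)_x` solutions are Type I"; an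
  ε-regularity/rescaling statement strictly weaker than regularity).

The composition is plumbing (restriction to `D`); the two stubs are the content. Alternative line
(not typed here): the PRESSURE CLOCK — Danskin's envelope theorem for `M(t) = max_x Π̃(t,·)` with
`HeadMaxPointLemma` gives `D⁺M ≤ (∂ₜ p̃)(t, x_t)` at the argmax, so `(T - t) ∂ₜp̃ ≤ Π̃ + C₀` at
head peaks would integrate to the Type-I rate.
-/

set_option linter.dupNamespace false

namespace Summit.NavierStokesRegularity.NavierStokesRegularity.Cruxes.DeceleratingSetHeadBound.BirthHeadTypeIOnDeceleratingSet

open Set Metric Function MeasureTheory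
open scoped ENNReal
open Literature.Analysis.FluidPDE
open Summit.NavierStokesRegularity.NavierStokesRegularity.Theses.BernoulliDeceleration

/-- Local copy of the child (VERBATIM the `statement` of `HeadTypeIOnDeceleratingSet` in
children.json; after the split, the route decl of the same name). -/
def HeadTypeIOnDeceleratingSet : Prop :=
  ∀ (ν T : ℝ), 0 < ν → 0 < T → ∀ (u : ℝ → EuclideanSpace ℝ (Fin 3) → EuclideanSpace ℝ (Fin 3)) (p : ℝ → EuclideanSpace ℝ (Fin 3) → ℝ), Literature.Analysis.FluidPDE.IsClassicalNSSolutionOn (Set.Ico 0 T) ν 0 u p → Literature.Analysis.FluidPDE.IsLerayHopfOn T ν 0 (u 0) u → Literature.Analysis.FluidPDE.HasRapidSpatialDecay (u 0) → ∃ C : ℝ, ∀ t ∈ Set.Ico 0 T, ∀ x, Literature.Analysis.FluidPDE.timeDerivWithin (Set.Ico 0 T) (fun s z => ‖u s z‖ ^ 2) t x ≤ -(2 * ν * ‖Literature.Analysis.FluidPDE.curl (u t) x‖ ^ 2) → (T - t) * (‖u t x‖ ^ 2 / 2 + Literature.Analysis.FluidPDE.normalisedPressure (u t) x) ≤ C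

/-- Stub A's statement: bounded critical one-sided integrability of the head. -/
def CriticalHeadIntegrability : Prop :=
  ∀ (ν T : ℝ), 0 < ν → 0 < T → ∀ (u : ℝ → EuclideanSpace ℝ (Fin 3) → EuclideanSpace ℝ (Fin 3)) (p : ℝ → EuclideanSpace ℝ (Fin 3) → ℝ), Literature.Analysis.FluidPDE.IsClassicalNSSolutionOn (Set.Ico 0 T) ν 0 u p → Literature.Analysis.FluidPDE.IsLerayHopfOn T ν 0 (u 0) u → Literature.Analysis.FluidPDE.HasRapidSpatialDecay (u 0) → ∃ Λ : ENNReal, Λ < ⊤ ∧ ∀ t ∈ Set.Ico 0 T, ∫⁻ x, ENNReal.ofReal (‖u t x‖ ^ 2 / 2 + Literature.Analysis.FluidPDE.normalisedPressure (u t) x) ^ (3 / 2 : ℝ) ≤ Λ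

/-- Stub B's statement: critical one-sided integrability forces the Type-I rate. -/
def TypeIRateOfCriticalHead : Prop :=
  ∀ (ν T : ℝ), 0 < ν → 0 < T → ∀ (u : ℝ → EuclideanSpace ℝ (Fin 3) → EuclideanSpace ℝ (Fin 3)) (p : ℝ → EuclideanSpace ℝ (Fin 3) → ℝ), Literature.Analysis.FluidPDE.IsClassicalNSSolutionOn (Set.Ico 0 T) ν 0 u p → Literature.Analysis.FluidPDE.IsLerayHopfOn T ν 0 (u 0) u → Literature.Analysis.FluidPDE.HasRapidSpatialDecay (u 0) → (∃ Λ : ENNReal, Λ < ⊤ ∧ ∀ t ∈ Set.Ico 0 T, ∫⁻ x, ENNReal.ofReal (‖u t x‖ ^ 2 / 2 + Literature.Analysis.FluidPDE.normalisedPressure (u t) x) ^ (3 / 2 : ℝ) ≤ Λ) → ∃ C : ℝ, ∀ t ∈ Set.Ico 0 T, ∀ x, (T - t) * (‖u t x‖ ^ 2 / 2 + Literature.Analysis.FluidPDE.normalisedPressure (u t) x) ≤ C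

/-- STUB A: `sup_(t<T) ∫ (Π̃₊(t,x))^(3/2) dx < ∞` for classical Leray–Hopf solutions from rapidly
decaying data (critical, one-sided a-priori bound; the route's energy-on-`D` bet). [XL; open] -/
theorem stub_criticalHeadIntegrability : CriticalHeadIntegrability := by
  sorry

/-- STUB B: a bounded critical one-sided norm of the head forces the Type-I rate
`(T - t) Π̃ ≤ C` on `[0, T) × ℝ³`. [L; open — rescaling / ε-regularity-type upgrade] -/
theorem stub_typeIRateOfCriticalHead : TypeIRateOfCriticalHead := by
  sorry

/-- **The child from the stubs** (plumbing: B ∘ A, restricted to the decelerating set). -/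
theorem HeadTypeIOnDeceleratingSet_of :
    CriticalHeadIntegrability → TypeIRateOfCriticalHead → HeadTypeIOnDeceleratingSet := by
  intro hA hB ν T hν hT u p hsol hLH hdec
  obtain ⟨C, hC⟩ := hB ν T hν hT u p hsol hLH hdec (hA ν T hν hT u p hsol hLH hdec)
  exact ⟨C, fun t ht x _ => hC t ht x⟩

end Summit.NavierStokesRegularity.NavierStokesRegularity.Cruxes.DeceleratingSetHeadBound.BirthHeadTypeIOnDeceleratingSet
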